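import Mathlib

/-!
# `Balaban1983to89.B4Strip` — the j-uniform complex strip behind Lemma 2.4 (2.35)–(2.36) of
T. Bałaban, *Regularity and decay of lattice Green's functions*, Commun. Math. Phys. **89**, 571–597 (1983)
[Balaban1983RegularityDecay] (cell paper B4), p. 586 [PDF 16].

CITATION HEADER (lean-in-tree rule 2026-08-18).  This module is a SUPPLEMENT to the typed skeleton `…Balaban1983to89.B4`
(sibling file, untouched; its leaf `B4.Lemma24Printed` = (2.35)–(2.37) p. 582 is what this supplement serves).  It is NOT a
quotation of the paper: B4 proves (2.35)–(2.36) by the momentum representation (2.43)–(2.49), bounds the integrand for REAL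
momenta ((2.50)–(2.51), p. 586 l. 1–8) and then ASSERTS, without proof, the load-bearing step (p. 586 l. 9–11, verbatim):
"The expression is a function of p′ and can be extended as an analytic function to some neighbourhood of [−π,π]^d.  It is
more troublesome, but equally elementary, to prove that this neighbourhood can be chosen independently of j and that the
expression is bounded also in this neighbourhood."  (audit census G-B4-02 / G-B4-02a; inherited verbatim by B5 Prop. 1.2,
CMP 95:17, p. 22, census G-B5-06a(b), and by B6 Prop. 2.5.)  The cell `pub-balaban` SUPPLIES the missing proof in
`HOME/b2b-balaban-b04-g2/StripLemma.md` (explicit constants; inputs: the displayed formulas (2.44)–(2.49) as definitions,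
Cauchy's Estimate [Conway, *Functions of One Complex Variable I*, GTM 11 (1978), IV.2.14 p. 73], calculus).  THIS FILE holds
the kernel-checked part of that proof, CONCRETELY over Mathlib (no abstract carriers):
 * §1 the momentum symbols of (2.45)/(2.49) continued to complex momenta `p′ ∈ ℂ^d` (`S1`, `Sxi`, `DeltaXi` = "Δ^ξ(p)+m²",
   `Delta1` = "Δ¹(p′)+m²", the block-averaging weight `U` = continuation of |u_j(p′+l)|² with its removable singularity filled,
   residues `l_μ = 2πk_μ`, `k : Fin d → Fin n`, `n = L^j`), and the REGROUPED DENOMINATOR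
   `E = (Δ^ξ+m²)(p′)·[1 + a Σ_{l′}|u(p′+l′)|²/(Δ^ξ+m²)(p′+l′)]` written as a polynomial in the symbols (`E`, `E_eq_mul`);
 * §2 REAL POSITIVITY, uniformly in `n ≥ 1`, `m² ≥ 0`, `a ≥ 0`: `E(s) ≥ a(2/π)^{2d}` on the Brillouin zone (`Er_ge`, `E_re_ge`)
   — the printed half (2.50) with its O(1) made explicit (Jordan's inequality `Real.mul_le_sin`);
 * §3 the ARCHITECTURE of the unwritten half, moduli only: real positivity + an imaginary-direction Lipschitz bound `Λ` ⇒
   `|E| ≥ ½a(2/π)^{2d}` on the strip `|Im p′_μ| ≤ κ` whenever `Λ d κ ≤ ½a(2/π)^{2d}` (`strip_lower_bound`,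
   `E_lower_of_ImLipschitz`), and the typed statement `UniformStrip` with its reduction `uniformStrip_of_uniformImLipschitz`
   to the single analytic leaf `UniformImLipschitz` (discharged in StripLemma.md Lemma A + C by Cauchy's Estimate with
   `Λ = M_E/r`, `r = 1/(2√d)`, `M_E` independent of `n` — which is the asserted j-independence);
 * §4 the census SUB-FINDING G-B4-02b, certified: the factorisation displayed in (2.49) does NOT continue factor by factor —
   for `m_j = 0`, `d = 2`, `L^j = 2` the continued `Δ^ξ+m²` vanishes at `p⋆(t) = (t, 4i·arsinh(sin(t/4)))`, a point of every
   strip, where `Δ¹+m² = −32 sin⁴(t/4) ≠ 0` (`printed_factor_has_poles`); so the printed factor `Δ¹(p′)/Δ^ξ(p′)` has poles in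
   every complex neighbourhood of [−π,π]^d and only the regrouped `E` can carry the argument (the printed SENTENCE, about the
   whole expression, is true — StripLemma.md Lemma S).
NOTHING of the series is asserted; no `…Printed` Prop of the sibling modules is used.  No `sorry`, no axiom, no `opaque`.
Staged byte-identically in the cell package
`run/shared/lean/pub/pub-balaban/lean/BalabanYm4/Literature/MathematicalPhysics/QuantumFieldTheory/Balaban1983to89/B4Strip.lean`.
Unit `b2b-balaban-b04-g2` (paper sub-cell B04, gen 2).  Companion records: `HOME/b2b-balaban-b04-g2/StripLemma.md` (proof),
`N-B4g2-1.md` (two-engine numerics), GAPS.md rows G-B4-02a (closed by supplied proof) / G-B4-02b (sub-finding).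
v2 (unit `b2b-balaban-b04-g3`, DOCFIX G-pv10-2 of the cross-read C-pv10-9): docstrings only — the transcription of (2.45) in
`U`, the page locators ((2.42)–(2.46) are printed on p. 584 [PDF 14], (2.47)–(2.49) on p. 585, (2.50)–(2.51) on p. 586), and
the printed sentence quoted in `Er_ge`; no declaration, statement or proof changed.
-/

namespace Literature.MathematicalPhysics.QuantumFieldTheory.Balaban1983to89.B4Strip

open Complex Finset

noncomputable section

/-- `S₁(z) = 2 − 2 cos z`. [cite: Balaban1983RegularityDecay, (2.45) p.584 / (2.49) p.585] -/
def S1 (z : ℂ) : ℂ := 2 - 2 * Complex.cos z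

/-- `S_ξ(z) = n² (2 − 2 cos (z/n))`, `ξ = 1/n`. [cite: Balaban1983RegularityDecay, (2.45) p.584] -/
def Sxi (n : ℕ) (z : ℂ) : ℂ := (n : ℂ) ^ 2 * (2 - 2 * Complex.cos (z / n))

/-- real form of `S₁`: `2 − 2cos x = |e^{−ix} − 1|²` ("Δ¹" summand of (2.49)). [cite: Balaban1983RegularityDecay, (2.49) p.585] -/
def S1r (x : ℝ) : ℝ := 2 - 2 * Real.cos x

/-- real form of `S_ξ`: `n²(2 − 2cos(x/n)) = |(e^{−iξx} − 1)/ξ|²`. [cite: Balaban1983RegularityDecay, (2.45) p.584] -/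
def Sxir (n : ℕ) (x : ℝ) : ℝ := (n : ℝ) ^ 2 * (2 - 2 * Real.cos (x / n))

/-- `S₁` is real on real arguments. [folklore] -/
theorem S1_ofReal (x : ℝ) : S1 (x : ℂ) = ((S1r x : ℝ) : ℂ) := by
  unfold S1 S1r; push_cast; ring

/-- `S_ξ` is real on real arguments. [folklore] -/
theorem Sxi_ofReal (n : ℕ) (x : ℝ) : Sxi n (x : ℂ) = ((Sxir n x : ℝ) : ℂ) := by
  unfold Sxi Sxir; push_cast; ring

/-- `2 − 2cos x = 4 sin²(x/2)`. [folklore] -/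
theorem S1r_eq (x : ℝ) : S1r x = 4 * Real.sin (x / 2) ^ 2 := by
  unfold S1r; rw [Real.sin_sq_eq_half_sub]; ring_nf

/-- `n²(2 − 2cos(x/n)) = 4n² sin²(x/2n)`. [folklore] -/
theorem Sxir_eq (n : ℕ) (x : ℝ) : Sxir n x = 4 * (n : ℝ) ^ 2 * Real.sin (x / (2 * n)) ^ 2 := by
  unfold Sxir; rw [Real.sin_sq_eq_half_sub]
  have : 2 * (x / (2 * (n : ℝ))) = x / n := by ring
  rw [this]; ring

/-- `S₁ ≥ 0` on the reals. [folklore] -/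
theorem S1r_nonneg (x : ℝ) : 0 ≤ S1r x := by
  rw [S1r_eq]; positivity

/-- `S_ξ ≥ 0` on the reals. [folklore] -/
theorem Sxir_nonneg (n : ℕ) (x : ℝ) : 0 ≤ Sxir n x := by
  rw [Sxir_eq]; positivity

/-- Jordan: `4 sin²(x/2) ≥ 4x²/π²` for `|x| ≤ π`. [folklore] -/
theorem S1r_ge (x : ℝ) (hx : |x| ≤ Real.pi) : 4 * x ^ 2 / Real.pi ^ 2 ≤ S1r x := by
  rw [S1r_eq]
  have hpi := Real.pi_pos
  -- reduce to |x|
  have key : ∀ y : ℝ, 0 ≤ y → y ≤ Real.pi → 4 * y ^ 2 / Real.pi ^ 2 ≤ 4 * Real.sin (y / 2) ^ 2 := by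
    intro y hy0 hy1
    have h1 : 2 / Real.pi * (y / 2) ≤ Real.sin (y / 2) :=
      Real.mul_le_sin (by linarith) (by linarith)
    have h0 : 0 ≤ 2 / Real.pi * (y / 2) := by positivity
    have h2 : (2 / Real.pi * (y / 2)) ^ 2 ≤ Real.sin (y / 2) ^ 2 := by
      exact pow_le_pow_left₀ h0 h1 2
    have h3 : 4 * y ^ 2 / Real.pi ^ 2 = 4 * (2 / Real.pi * (y / 2)) ^ 2 := by
      field_simp
    rw [h3]; linarith
  rcases le_or_gt 0 x with h | h
  · exact key x h (by rwa [abs_of_nonneg h] at hx)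
  · have := key (-x) (by linarith) (by rwa [abs_of_neg h] at hx)
    have e1 : Real.sin (-x / 2) ^ 2 = Real.sin (x / 2) ^ 2 := by
      rw [show -x / 2 = -(x / 2) by ring, Real.sin_neg]; ring
    rw [e1] at this; simpa using this

/-- `S_ξ(x) ≤ x²`. [folklore] -/
theorem Sxir_le (n : ℕ) (x : ℝ) : Sxir n x ≤ x ^ 2 := by
  rw [Sxir_eq]
  rcases Nat.eq_zero_or_pos n with hn | hn
  · subst hn; simp; positivity
  have hn' : (0 : ℝ) < n := by exact_mod_cast hn
  have h1 : |Real.sin (x / (2 * n))| ≤ |x / (2 * n)| := Real.abs_sin_le_abs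
  have h2 : Real.sin (x / (2 * n)) ^ 2 ≤ (x / (2 * n)) ^ 2 := by
    rw [← sq_abs (Real.sin _), ← sq_abs (x / (2 * (n:ℝ)))]
    exact pow_le_pow_left₀ (abs_nonneg _) h1 2
  have h3 : 4 * (n : ℝ) ^ 2 * (x / (2 * n)) ^ 2 = x ^ 2 := by
    field_simp; ring
  calc 4 * (n : ℝ) ^ 2 * Real.sin (x / (2 * n)) ^ 2 ≤ 4 * (n : ℝ) ^ 2 * (x / (2 * n)) ^ 2 := by
        apply mul_le_mul_of_nonneg_left h2; positivity
    _ = x ^ 2 := h3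

/-- `S_ξ(x) > 0` for `0 < |x| ≤ π`, `n ≥ 1`. [folklore] -/
theorem Sxir_pos (n : ℕ) (hn : 1 ≤ n) (x : ℝ) (hx0 : x ≠ 0) (hx : |x| ≤ Real.pi) : 0 < Sxir n x := by
  rw [Sxir_eq]
  have hn' : (1 : ℝ) ≤ n := by exact_mod_cast hn
  have hpi := Real.pi_pos
  have hy : |x / (2 * n)| ≤ Real.pi / 2 := by
    rw [abs_div, abs_of_pos (by positivity : (0:ℝ) < 2 * n)]
    rw [div_le_iff₀ (by positivity)]
    nlinarith
  have hy0 : x / (2 * n) ≠ 0 := by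
    intro h; apply hx0
    field_simp at h; simpa using h
  have hs : Real.sin (x / (2 * n)) ≠ 0 := by
    intro h
    rw [Real.sin_eq_zero_iff_of_lt_of_lt] at h
    · exact hy0 h
    · have := (abs_le.mp hy).1; linarith
    · have := (abs_le.mp hy).2; linarith
  have hn2 : (0:ℝ) < 4 * (n:ℝ) ^ 2 := by positivity
  have : 0 < Real.sin (x / (2 * n)) ^ 2 := by positivity
  positivity

/-- the ratio `ρ_n(x) = S₁(x)/S_ξ(x) ≥ 4/π²` for `0 < |x| ≤ π`. [folklore] -/
theorem ratio_ge (n : ℕ) (hn : 1 ≤ n) (x : ℝ) (hx0 : x ≠ 0) (hx : |x| ≤ Real.pi) :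
    4 / Real.pi ^ 2 ≤ S1r x / Sxir n x := by
  have hpos := Sxir_pos n hn x hx0 hx
  rw [le_div_iff₀ hpos]
  have h1 := S1r_ge x hx
  have h2 := Sxir_le n x
  have hpi := Real.pi_pos
  calc 4 / Real.pi ^ 2 * Sxir n x ≤ 4 / Real.pi ^ 2 * x ^ 2 := by
        apply mul_le_mul_of_nonneg_left h2; positivity
    _ = 4 * x ^ 2 / Real.pi ^ 2 := by ring
    _ ≤ S1r x := h1


/-! ### Momentum vectors, the averaging symbol, the regrouped denominator -/

variable {d : ℕ}

/-- embed a real momentum vector [folklore] -/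
def ofRealVec (s : Fin d → ℝ) : Fin d → ℂ := fun μ => (s μ : ℂ)

/-- the shifted momentum `p' + l`, `l_μ = 2π k_μ`, `k_μ ∈ {0,…,n-1}` (representatives of `l ∈ Λ̃`, (2.44)) [cite: Balaban1983RegularityDecay, (2.44)–(2.45) p.584] -/
def shift (n : ℕ) (k : Fin d → Fin n) (p : Fin d → ℂ) : Fin d → ℂ :=
  fun μ => p μ + 2 * Real.pi * ((k μ : ℕ) : ℂ)

/-- real form of `shift`. [folklore] -/
def shiftr (n : ℕ) (k : Fin d → Fin n) (s : Fin d → ℝ) : Fin d → ℝ :=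
  fun μ => s μ + 2 * Real.pi * ((k μ : ℕ) : ℝ)

/-- `Δ^ξ(p) + m² = Σ_μ S_ξ(p_μ) + m²` (Fourier symbol of `−Δ^ξ + m²` on the `ξ`-lattice, continued to `ℂ^d`). [cite: Balaban1983RegularityDecay, (2.45) p.584] -/
def DeltaXi (n : ℕ) (m2 : ℝ) (p : Fin d → ℂ) : ℂ := (∑ μ, Sxi n (p μ)) + m2

/-- real form of `DeltaXi`. [folklore] -/
def DeltaXir (n : ℕ) (m2 : ℝ) (s : Fin d → ℝ) : ℝ := (∑ μ, Sxir n (s μ)) + m2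

/-- `Δ¹(p') + m² = Σ_μ S₁(p'_μ) + m²` (symbol of `−Δ¹ + m²` on the unit lattice). [cite: Balaban1983RegularityDecay, (2.49) p.585] -/
def Delta1 (m2 : ℝ) (p : Fin d → ℂ) : ℂ := (∑ μ, S1 (p μ)) + m2

/-- real form of `Delta1`. [folklore] -/
def Delta1r (m2 : ℝ) (s : Fin d → ℝ) : ℝ := (∑ μ, S1r (s μ)) + m2

/-- one factor of `|u(p'+l)|²` continued to complex `p'`: for `l_μ = 0` it is `S₁(z)/S_ξ(z)` with the removable
singularity at `z = 0` filled by its value `1`; for `l_μ ≠ 0` it is `S₁(z)/S_ξ(z + l_μ)`. [cite: Balaban1983RegularityDecay, (2.45) p.584] -/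
def uFactor (n : ℕ) (k : ℕ) (z : ℂ) : ℂ :=
  if k = 0 then (if z = 0 then 1 else S1 z / Sxi n z)
  else S1 z / Sxi n (z + 2 * Real.pi * (k : ℂ))

/-- real form of `uFactor`. [folklore] -/
def uFactorr (n : ℕ) (k : ℕ) (x : ℝ) : ℝ :=
  if k = 0 then (if x = 0 then 1 else S1r x / Sxir n x)
  else S1r x / Sxir n (x + 2 * Real.pi * (k : ℝ))

/-- `U_l(p') = Π_μ uFactor` = the continuation of `|u_j(p'+l)|²` ((2.45) p. 584 prints
`u_j(p) = Π_{μ=1}^{d} (e^{−i p_μ} − 1)/((e^{−i ξ p_μ} − 1)/ξ)`, `ξ = L^{−j} = 1/n`; hence for real `p'` and `l_μ = 2π m'_μ`,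
using `e^{−i (p'+l)_μ} = e^{−i p'_μ}`:  `|u_j(p'+l)|² = Π_μ S₁(p'_μ)/S_ξ(p'_μ + l_μ)`). [cite: Balaban1983RegularityDecay, (2.45)–(2.46) p.584, (2.47)–(2.48) p.585] -/
def U (n : ℕ) (k : Fin d → Fin n) (p : Fin d → ℂ) : ℂ := ∏ μ, uFactor n (k μ : ℕ) (p μ)

/-- real form of `U` (= the printed |u_j(p′+l)|² for real p′). [folklore] -/
def Ur (n : ℕ) (k : Fin d → Fin n) (s : Fin d → ℝ) : ℝ := ∏ μ, uFactorr n (k μ : ℕ) (s μ)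

/-- THE REGROUPED DENOMINATOR `E(p') = (Δ^ξ(p')+m²) · [1 + a Σ_{l'} |u(p'+l')|² (Δ^ξ(p'+l')+m²)⁻¹]`
  `= (Δ^ξ(p')+m²) + a U₀(p') + a Σ_{l' ≠ 0} U_{l'}(p') (Δ^ξ(p')+m²)/(Δ^ξ(p'+l')+m²)`,
the entire-in-the-strip combination through which (2.49) must be bounded (see `pole_witness` below: the factor
`(Δ¹(p')+m²)/(Δ^ξ(p')+m²)` of the printed factorisation is NOT bounded in any complex strip, uniformly or not). [cite: Balaban1983RegularityDecay, (2.46) p.584, (2.47)–(2.48) p.585 (the bracket, regrouped by the audit)] -/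
def E (n : ℕ) [NeZero n] (a m2 : ℝ) (p : Fin d → ℂ) : ℂ :=
  DeltaXi n m2 p + a * U n (fun _ => (0 : Fin n)) p
    + a * ∑ k ∈ (Finset.univ.erase (fun _ => (0 : Fin n))),
        U n k p * (DeltaXi n m2 p / DeltaXi n m2 (shift n k p))

/-- real form of the regrouped denominator `E`. [folklore] -/
def Er (n : ℕ) [NeZero n] (a m2 : ℝ) (s : Fin d → ℝ) : ℝ :=
  DeltaXir n m2 s + a * Ur n (fun _ => (0 : Fin n)) s
    + a * ∑ k ∈ (Finset.univ.erase (fun _ => (0 : Fin n))),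
        Ur n k s * (DeltaXir n m2 s / DeltaXir n m2 (shiftr n k s))

/-- `uFactor` is real on real arguments. [folklore] -/
theorem uFactor_ofReal (n k : ℕ) (x : ℝ) : uFactor n k (x : ℂ) = ((uFactorr n k x : ℝ) : ℂ) := by
  unfold uFactor uFactorr
  by_cases hk : k = 0
  · subst hk; by_cases hx : x = 0
    · subst hx; simp
    · simp [hx, S1_ofReal, Sxi_ofReal]
  · simp only [hk, if_false]
    have : (x : ℂ) + 2 * Real.pi * (k : ℂ) = ((x + 2 * Real.pi * (k : ℝ) : ℝ) : ℂ) := by push_cast; ring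
    rw [this, S1_ofReal, Sxi_ofReal]; push_cast; ring

/-- `U` is real on real momenta. [folklore] -/
theorem U_ofReal (n : ℕ) (k : Fin d → Fin n) (s : Fin d → ℝ) :
    U n k (ofRealVec s) = ((Ur n k s : ℝ) : ℂ) := by
  unfold U Ur ofRealVec; push_cast
  exact Finset.prod_congr rfl (fun μ _ => uFactor_ofReal n _ (s μ))

/-- `DeltaXi` is real on real momenta. [folklore] -/
theorem DeltaXi_ofReal (n : ℕ) (m2 : ℝ) (s : Fin d → ℝ) :
    DeltaXi n m2 (ofRealVec s) = ((DeltaXir n m2 s : ℝ) : ℂ) := by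
  unfold DeltaXi DeltaXir ofRealVec; push_cast
  congr 1; exact Finset.sum_congr rfl (fun μ _ => Sxi_ofReal n (s μ))

/-- `Delta1` is real on real momenta. [folklore] -/
theorem Delta1_ofReal (m2 : ℝ) (s : Fin d → ℝ) :
    Delta1 m2 (ofRealVec s) = ((Delta1r m2 s : ℝ) : ℂ) := by
  unfold Delta1 Delta1r ofRealVec; push_cast
  congr 1; exact Finset.sum_congr rfl (fun μ _ => S1_ofReal (s μ))

/-- `shift` commutes with the real embedding. [folklore] -/
theorem shift_ofReal (n : ℕ) (k : Fin d → Fin n) (s : Fin d → ℝ) :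
    shift n k (ofRealVec s) = ofRealVec (shiftr n k s) := by
  funext μ; unfold shift shiftr ofRealVec; push_cast; ring

/-- on real momenta the regrouped denominator is the real number `Er`. [folklore] -/
theorem E_ofReal (n : ℕ) [NeZero n] (a m2 : ℝ) (s : Fin d → ℝ) :
    E n a m2 (ofRealVec s) = ((Er n a m2 s : ℝ) : ℂ) := by
  unfold E Er
  simp only [U_ofReal, DeltaXi_ofReal, shift_ofReal]
  push_cast; rfl


/-! ### Real positivity: `E ≥ a (2/π)^{2d}` on real momenta, uniformly in `n ≥ 1`, `m² ≥ 0` -/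

/-- `4/π² ≤ 1`. [folklore] -/
theorem four_div_pi_sq_le_one : 4 / Real.pi ^ 2 ≤ (1 : ℝ) := by
  have h := Real.pi_gt_three
  rw [div_le_one (by positivity)]; nlinarith

/-- every factor of |u|² is `≥ 0` on the reals. [folklore] -/
theorem uFactorr_nonneg (n k : ℕ) (x : ℝ) : 0 ≤ uFactorr n k x := by
  unfold uFactorr
  split_ifs
  · exact zero_le_one
  · exact div_nonneg (S1r_nonneg _) (Sxir_nonneg _ _)
  · exact div_nonneg (S1r_nonneg _) (Sxir_nonneg _ _)

/-- the unshifted factor `ρ_n(x) ≥ 4/π²` on `|x| ≤ π` (Jordan). [folklore] -/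
theorem uFactorr_zero_ge (n : ℕ) (hn : 1 ≤ n) (x : ℝ) (hx : |x| ≤ Real.pi) :
    4 / Real.pi ^ 2 ≤ uFactorr n 0 x := by
  unfold uFactorr
  simp only [if_true]
  by_cases h0 : x = 0
  · simp [h0]; exact four_div_pi_sq_le_one
  · simp only [h0, if_false]; exact ratio_ge n hn x h0 hx

/-- `U_l ≥ 0` on the reals. [folklore] -/
theorem Ur_nonneg (n : ℕ) (k : Fin d → Fin n) (s : Fin d → ℝ) : 0 ≤ Ur n k s :=
  Finset.prod_nonneg (fun _ _ => uFactorr_nonneg _ _ _)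

/-- `U₀(s) = |u_j(s)|² ≥ (4/π²)^d` on the Brillouin zone, all `n ≥ 1` (the O(1) of (2.50) made explicit). [folklore] -/
theorem Ur_zero_ge (n : ℕ) [NeZero n] (hn : 1 ≤ n) (s : Fin d → ℝ) (hs : ∀ μ, |s μ| ≤ Real.pi) :
    (4 / Real.pi ^ 2) ^ d ≤ Ur n (fun _ => (0 : Fin n)) s := by
  unfold Ur
  have : (4 / Real.pi ^ 2) ^ d = ∏ _μ : Fin d, (4 / Real.pi ^ 2 : ℝ) := by
    rw [Finset.prod_const, Finset.card_univ, Fintype.card_fin]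
  rw [this]
  apply Finset.prod_le_prod
  · intro μ _; positivity
  · intro μ _; simpa using uFactorr_zero_ge n hn (s μ) (hs μ)

/-- `(Δ^ξ+m²)(s) ≥ 0` on the reals for `m² ≥ 0`. [folklore] -/
theorem DeltaXir_nonneg (n : ℕ) (m2 : ℝ) (hm : 0 ≤ m2) (s : Fin d → ℝ) : 0 ≤ DeltaXir n m2 s := by
  unfold DeltaXir
  have : 0 ≤ ∑ μ, Sxir n (s μ) := Finset.sum_nonneg (fun μ _ => Sxir_nonneg _ _)
  linarith

/-- `(Δ¹+m²)(s) ≥ 0` on the reals for `m² ≥ 0`. [folklore] -/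
theorem Delta1r_nonneg (m2 : ℝ) (hm : 0 ≤ m2) (s : Fin d → ℝ) : 0 ≤ Delta1r m2 s := by
  unfold Delta1r
  have : 0 ≤ ∑ μ, S1r (s μ) := Finset.sum_nonneg (fun μ _ => S1r_nonneg _)
  linarith

/-- REAL POSITIVITY (the printed half of the argument — p. 585, last two lines: "It is easy to prove that the
underintegral expression is bounded because", followed by the four displayed factor bounds for real `p'`, and p. 586,
"hence" (2.50) `a_j Σ_{l'} |u_j(p'+l')|² Δ¹(p')/Δ^ξ(p'+l') + Δ¹(p') ≥ a_j |u_j(p')| Δ¹(p')/Δ^ξ(p') ≥ O(1) > 0`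
[sic: `|u_j(p')|`, the square is meant], "and we have" (2.51)): on the real Brillouin zone `|p'_μ| ≤ π` the regrouped
denominator satisfies `E(p') ≥ a (4/π²)^d = a (2/π)^{2d}`, for every `n = L^j ≥ 1`, every `m² ≥ 0`, every `a ≥ 0`
— the `O(1)` of (2.50) made explicit and transported from the `Δ¹`-normalised bracket to `E`. [folklore] -/
theorem Er_ge (n : ℕ) [NeZero n] (hn : 1 ≤ n) (a m2 : ℝ) (ha : 0 ≤ a) (hm : 0 ≤ m2)
    (s : Fin d → ℝ) (hs : ∀ μ, |s μ| ≤ Real.pi) :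
    a * (4 / Real.pi ^ 2) ^ d ≤ Er n a m2 s := by
  unfold Er
  have h1 := DeltaXir_nonneg n m2 hm s
  have h2 := Ur_zero_ge n hn s hs
  have h3 : 0 ≤ ∑ k ∈ (Finset.univ.erase (fun _ => (0 : Fin n))),
        Ur n k s * (DeltaXir n m2 s / DeltaXir n m2 (shiftr n k s)) := by
    apply Finset.sum_nonneg; intro k _
    exact mul_nonneg (Ur_nonneg _ _ _) (div_nonneg h1 (DeltaXir_nonneg n m2 hm _))
  have h4 : a * (4 / Real.pi ^ 2) ^ d ≤ a * Ur n (fun _ => (0 : Fin n)) s := mul_le_mul_of_nonneg_left h2 ha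
  nlinarith [mul_nonneg ha h3]

/-- real positivity in modulus form: `‖E(s)‖ ≥ a(4/π²)^d` on the Brillouin zone. [folklore] -/
theorem E_re_ge (n : ℕ) [NeZero n] (hn : 1 ≤ n) (a m2 : ℝ) (ha : 0 ≤ a) (hm : 0 ≤ m2)
    (s : Fin d → ℝ) (hs : ∀ μ, |s μ| ≤ Real.pi) :
    a * (4 / Real.pi ^ 2) ^ d ≤ ‖E n a m2 (ofRealVec s)‖ := by
  rw [E_ofReal, Complex.norm_real]
  exact (Er_ge n hn a m2 ha hm s hs).trans (le_abs_self _)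

/-! ### The strip: modulus-only architecture of the uniform lower bound -/

/-- the complex strip around the Brillouin zone: `|Re p'_μ| ≤ π`, `|Im p'_μ| ≤ κ`. [folklore] -/
def Strip (d : ℕ) (κ : ℝ) : Set (Fin d → ℂ) := {p | ∀ μ, |(p μ).re| ≤ Real.pi ∧ |(p μ).im| ≤ κ}

/-- the real part of a strip point, as a real momentum vector [folklore] -/
def reVec (p : Fin d → ℂ) : Fin d → ℝ := fun μ => (p μ).re

/-- ABSTRACT PERTURBATION LEMMA (kernel of the unwritten step): a function on the strip which is `≥ 2c` in modulus
on real momenta and `Λ`-Lipschitz in the imaginary directions (sum norm) is `≥ c` in modulus on the strip of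
half-width `κ` as soon as `Λ d κ ≤ c`.  Only MODULI enter — no argument / sector bookkeeping. [folklore] -/
theorem strip_lower_bound (g : (Fin d → ℂ) → ℂ) (c Λ κ : ℝ)
    (hreal : ∀ s : Fin d → ℝ, (∀ μ, |s μ| ≤ Real.pi) → 2 * c ≤ ‖g (ofRealVec s)‖)
    (hlip : ∀ p ∈ Strip d κ, ‖g p - g (ofRealVec (reVec p))‖ ≤ Λ * ∑ μ, |(p μ).im|)
    (hΛ : 0 ≤ Λ) (hsmall : Λ * (d * κ) ≤ c) :
    ∀ p ∈ Strip d κ, c ≤ ‖g p‖ := by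
  intro p hp
  have hs : ∀ μ, |(reVec p) μ| ≤ Real.pi := fun μ => (hp μ).1
  have h1 := hreal (reVec p) hs
  have h2 := hlip p hp
  have h3 : ∑ μ, |(p μ).im| ≤ d * κ := by
    calc ∑ μ, |(p μ).im| ≤ ∑ _μ : Fin d, κ := Finset.sum_le_sum (fun μ _ => (hp μ).2)
      _ = d * κ := by simp
  have h4 : ‖g p - g (ofRealVec (reVec p))‖ ≤ c := by
    calc ‖g p - g (ofRealVec (reVec p))‖ ≤ Λ * ∑ μ, |(p μ).im| := h2
      _ ≤ Λ * (d * κ) := mul_le_mul_of_nonneg_left h3 hΛ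
      _ ≤ c := hsmall
  have h5 : ‖g (ofRealVec (reVec p))‖ ≤ ‖g p‖ + ‖g p - g (ofRealVec (reVec p))‖ := by
    calc ‖g (ofRealVec (reVec p))‖ = ‖g p - (g p - g (ofRealVec (reVec p)))‖ := by ring_nf
      _ ≤ ‖g p‖ + ‖g p - g (ofRealVec (reVec p))‖ := norm_sub_le _ _
  linarith

/-- the imaginary-direction Lipschitz property of the regrouped denominator on the strip of half-width `κ`,
with constant `Λ`, for the parameters `(n, a, m²)`.  Discharged in the companion proof (StripLemma.md, Lemma C) by the
Cauchy inequality from the modulus bound of `E` on the fat region (Lemma A); it is the ONLY analytic input. [folklore] -/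
def ImLipschitz (d n : ℕ) [NeZero n] (a m2 κ Λ : ℝ) : Prop :=
  ∀ p ∈ Strip d κ, ‖E n a m2 p - E n a m2 (ofRealVec (reVec p))‖ ≤ Λ * ∑ μ, |(p μ).im|

/-- KERNEL FORM OF THE UNIFORM STRIP BOUND: real positivity + imaginary Lipschitz ⇒ `|E| ≥ ½ a (2/π)^{2d}` on the
strip `|Im p'_μ| ≤ κ` whenever `Λ d κ ≤ ½ a (2/π)^{2d}`; `n = L^j` enters only through `Λ`, and Lemma A/C of the
companion proof give `Λ` INDEPENDENT of `n ≥ 1` — this is the `j`-independence asserted on p. 586. [folklore] -/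
theorem E_lower_of_ImLipschitz (n : ℕ) [NeZero n] (hn : 1 ≤ n) (a m2 κ Λ : ℝ) (ha : 0 ≤ a) (hm : 0 ≤ m2)
    (hΛ : 0 ≤ Λ) (hL : ImLipschitz d n a m2 κ Λ)
    (hsmall : Λ * (d * κ) ≤ a * (4 / Real.pi ^ 2) ^ d / 2) :
    ∀ p ∈ Strip d κ, a * (4 / Real.pi ^ 2) ^ d / 2 ≤ ‖E n a m2 p‖ := by
  apply strip_lower_bound (E n a m2) _ Λ κ _ hL hΛ hsmall
  intro s hs
  have := E_re_ge n hn a m2 ha hm s hs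
  linarith


/-! ### The regrouping identity `E = (Δ^ξ+m²)·[1 + a Σ_{l'} |u(p'+l')|² (Δ^ξ(p'+l')+m²)⁻¹]` -/

/-- the zero residue does not shift. [folklore] -/
theorem shift_zero (n : ℕ) [NeZero n] (p : Fin d → ℂ) : shift n (fun _ => (0 : Fin n)) p = p := by
  funext μ; simp [shift]

/-- Where `Δ^ξ(p')+m² ≠ 0` the regrouped denominator IS the printed product `(Δ^ξ(p')+m²)·[…]` of (2.46)–(2.48);
`E` is the polynomial-in-the-symbols form that stays finite and analytic through the zeros of `Δ^ξ(p')+m²`. [folklore] -/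
theorem E_eq_mul (n : ℕ) [NeZero n] (a m2 : ℝ) (p : Fin d → ℂ) (h : DeltaXi n m2 p ≠ 0) :
    E n a m2 p = DeltaXi n m2 p * (1 + a * ∑ k : Fin d → Fin n, U n k p / DeltaXi n m2 (shift n k p)) := by
  unfold E
  rw [← Finset.add_sum_erase Finset.univ _ (Finset.mem_univ (fun _ => (0 : Fin n))), shift_zero]
  have e2 : ∑ k ∈ Finset.univ.erase (fun _ => (0 : Fin n)), U n k p * (DeltaXi n m2 p / DeltaXi n m2 (shift n k p))
      = DeltaXi n m2 p * ∑ k ∈ Finset.univ.erase (fun _ => (0 : Fin n)), U n k p / DeltaXi n m2 (shift n k p) := by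
    rw [Finset.mul_sum]; exact Finset.sum_congr rfl (fun k _ => by ring)
  rw [e2]
  generalize (∑ k ∈ Finset.univ.erase (fun _ => (0 : Fin n)), U n k p / DeltaXi n m2 (shift n k p)) = S
  field_simp
  ring

/-! ### The printed factorisation does not continue factor by factor (census sub-finding G-B4-02b)

(2.49) displays the integrand as `[a Σ_{l'}|u(p'+l')|² Δ¹(p')/Δ^ξ(p'+l') + Δ¹(p')]⁻¹ · ∂^ξ_μ(p'+l) u(p'+l) Δ¹(p')/Δ^ξ(p'+l)`
and bounds the four factors separately for REAL `p'` (p. 585).  For complex `p'` the third factor at `l = 0`,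
`(Δ¹(p')+m²)/(Δ^ξ(p')+m²)`, has POLES inside every strip `|Im p'_μ| ≤ κ` when `m_j = 0`, `d ≥ 2`, `L^j ≥ 2`
(exact zeros of the continued `Δ^ξ+m²` at which `Δ¹+m² ≠ 0`), and the first factor has poles at the zeros of
`Δ¹(p')+m²`; only their product — `1/E` times entire functions — is analytic.  Hence the unwritten step cannot be
"the displayed bounds, verbatim, for complex `p'`"; it needs the regrouped `E`.  Certified instance (`d = 2`,
`n = L^j = 2`, `m = 0`): `p⋆(t) = (t, 4i·arsinh(sin(t/4)))`, `(Δ^ξ+m²)(p⋆(t)) = 0`, `(Δ¹+m²)(p⋆(t)) = −32 sin⁴(t/4)`,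
`p⋆(t) ∈ Strip 2 κ` for `0 ≤ t ≤ min κ π`.  (General `n`: `p⋆ = (t, 2n·i·arsinh(sin(t/2n)), 0, …, 0)`.) -/

/-- the witness family `p⋆(t) = (t, 4i·arsinh(sin(t/4))) ∈ ℂ²`. [folklore] -/
def poleWitness (t : ℝ) : Fin 2 → ℂ := ![(t : ℂ), ((4 * Real.arsinh (Real.sin (t / 4)) : ℝ) : ℂ) * I]

/-- `cos(t/2)` of a real cast is the cast of the real cosine. [folklore] -/
private theorem cos_half_ofReal (t : ℝ) : Complex.cos ((t : ℂ) / 2) = ((Real.cos (t / 2) : ℝ) : ℂ) := by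
  rw [show (t : ℂ) / 2 = ((t / 2 : ℝ) : ℂ) by push_cast; ring, ← Complex.ofReal_cos]

/-- `cos(iy/2) = cosh(y/2)`. [folklore] -/
private theorem cos_half_imag (y : ℝ) : Complex.cos ((y : ℂ) * I / 2) = ((Real.cosh (y / 2) : ℝ) : ℂ) := by
  rw [show (y : ℂ) * I / 2 = ((y / 2 : ℝ) : ℂ) * I by push_cast; ring, Complex.cos_mul_I, ← Complex.ofReal_cosh]

/-- `cos(iy) = cosh y`. [folklore] -/
private theorem cos_imag (y : ℝ) : Complex.cos ((y : ℂ) * I) = ((Real.cosh y : ℝ) : ℂ) := by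
  rw [Complex.cos_mul_I, ← Complex.ofReal_cosh]

/-- `cos(t/2) = 1 − 2 sin²(t/4)`. [folklore] -/
private theorem real_cos_half (t : ℝ) : Real.cos (t / 2) = 1 - 2 * Real.sin (t / 4) ^ 2 := by
  have h := Real.cos_sq_add_sin_sq (t / 4)
  have h2 := Real.cos_two_mul (t / 4)
  rw [show 2 * (t / 4) = t / 2 by ring] at h2
  nlinarith

/-- `cos t` in terms of `sin(t/4)`. [folklore] -/
private theorem real_cos_full (t : ℝ) : Real.cos t = 2 * (1 - 2 * Real.sin (t / 4) ^ 2) ^ 2 - 1 := by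
  have h2 := Real.cos_two_mul (t / 2)
  rw [show 2 * (t / 2) = t by ring] at h2
  rw [h2, real_cos_half]

/-- `cosh(2 arsinh u) = 2u² + 1`. [folklore] -/
private theorem real_cosh_half (u : ℝ) : Real.cosh (4 * Real.arsinh u / 2) = 2 * u ^ 2 + 1 := by
  have h1 := Real.cosh_two_mul (Real.arsinh u)
  have h2 := Real.cosh_sq (Real.arsinh u)
  rw [show 4 * Real.arsinh u / 2 = 2 * Real.arsinh u by ring, h1, h2, Real.sinh_arsinh]; ring

/-- `cosh(4 arsinh u) = 8u²(1+u²) + 1`. [folklore] -/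
private theorem real_cosh_full (u : ℝ) : Real.cosh (4 * Real.arsinh u) = 8 * u ^ 2 * (1 + u ^ 2) + 1 := by
  have h1 := Real.cosh_two_mul (2 * Real.arsinh u)
  have h2 := Real.cosh_sq (2 * Real.arsinh u)
  have h3 := Real.sinh_two_mul (Real.arsinh u)
  have h4 : Real.cosh (Real.arsinh u) ^ 2 = 1 + u ^ 2 := by
    rw [Real.cosh_arsinh, Real.sq_sqrt (by positivity)]
  rw [Real.sinh_arsinh] at h3
  have h5 : Real.sinh (2 * Real.arsinh u) ^ 2 = 4 * u ^ 2 * (1 + u ^ 2) := by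
    rw [h3, mul_pow, h4]; ring
  rw [show 4 * Real.arsinh u = 2 * (2 * Real.arsinh u) by ring, h1, h2, h5]; ring

/-- `(Δ^ξ + m²)(p⋆(t)) = 0` exactly (`n = 2`, `m = 0`). [folklore] -/
theorem DeltaXi_poleWitness (t : ℝ) : DeltaXi 2 0 (poleWitness t) = 0 := by
  unfold DeltaXi poleWitness Sxi
  simp only [Fin.sum_univ_two, Matrix.cons_val_zero, Matrix.cons_val_one, Nat.cast_ofNat]
  rw [cos_half_ofReal, cos_half_imag, real_cos_half, real_cosh_half]
  push_cast; ring

/-- `(Δ¹ + m²)(p⋆(t)) = −32 sin⁴(t/4)` (`m = 0`). [folklore] -/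
theorem Delta1_poleWitness (t : ℝ) : Delta1 0 (poleWitness t) = ((-32 * Real.sin (t / 4) ^ 4 : ℝ) : ℂ) := by
  unfold Delta1 poleWitness S1
  simp only [Fin.sum_univ_two, Matrix.cons_val_zero, Matrix.cons_val_one]
  rw [← Complex.ofReal_cos, cos_imag, real_cos_full, real_cosh_full]
  push_cast; ring

/-- `arsinh v ≤ v` for `v ≥ 0`. [folklore] -/
theorem arsinh_le_self {v : ℝ} (hv : 0 ≤ v) : Real.arsinh v ≤ v := by
  rw [← Real.sinh_le_sinh, Real.sinh_arsinh]; exact Real.self_le_sinh_iff.mpr hv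

/-- `p⋆(t)` lies in the strip of half-width `κ` for `0 ≤ t ≤ min κ π`. [folklore] -/
theorem poleWitness_mem_Strip (t κ : ℝ) (ht0 : 0 ≤ t) (htκ : t ≤ κ) (htπ : t ≤ Real.pi) :
    poleWitness t ∈ Strip 2 κ := by
  have hpi := Real.pi_pos
  have hu0 : 0 ≤ Real.sin (t / 4) := Real.sin_nonneg_of_nonneg_of_le_pi (by linarith) (by linarith)
  have hu1 : Real.sin (t / 4) ≤ t / 4 := by
    have := Real.sin_le (by linarith : 0 ≤ t / 4); exact this
  have ha0 : 0 ≤ Real.arsinh (Real.sin (t / 4)) := Real.arsinh_nonneg_iff.mpr hu0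
  have ha1 : Real.arsinh (Real.sin (t / 4)) ≤ t / 4 := (arsinh_le_self hu0).trans hu1
  intro μ
  fin_cases μ
  · simp only [poleWitness, Fin.zero_eta, Matrix.cons_val_zero, Complex.ofReal_re, Complex.ofReal_im, abs_zero]
    exact ⟨by rw [abs_of_nonneg ht0]; exact htπ, by linarith⟩
  · simp only [poleWitness, Fin.mk_one, Matrix.cons_val_one, Matrix.cons_val_zero,
      Complex.mul_re, Complex.mul_im, Complex.ofReal_re, Complex.ofReal_im, Complex.I_re, Complex.I_im]
    constructor
    · simp; exact hpi.le
    · simp only [mul_zero, mul_one]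
      rw [abs_of_nonneg (by linarith)]; linarith

/-- SUB-FINDING, certified: in EVERY complex strip around the Brillouin zone (`d = 2`, `L^j = 2`, `m_j = 0`) the
continued symbol `Δ^ξ+m²` has an exact zero at which `Δ¹+m² ≠ 0`; hence the printed factor `(Δ¹(p')+m²)/(Δ^ξ(p')+m²)`
(the `l = 0` instance of the third factor of (2.49)) is unbounded on every strip, and the neighbourhood "independent of
`j`" of p. 586 can only refer to the regrouped expression. [folklore] -/
theorem printed_factor_has_poles (κ : ℝ) (hκ : 0 < κ) :
    ∃ p ∈ Strip 2 κ, DeltaXi 2 0 p = 0 ∧ Delta1 0 p ≠ 0 := by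
  have hpi := Real.pi_pos
  set t := min κ Real.pi with ht
  have ht0 : 0 < t := lt_min hκ hpi
  have htκ : t ≤ κ := min_le_left _ _
  have htπ : t ≤ Real.pi := min_le_right _ _
  refine ⟨poleWitness t, poleWitness_mem_Strip t κ ht0.le htκ htπ, DeltaXi_poleWitness t, ?_⟩
  rw [Delta1_poleWitness]
  have hs : 0 < Real.sin (t / 4) := Real.sin_pos_of_pos_of_lt_pi (by linarith) (by linarith)
  have : (-32 * Real.sin (t / 4) ^ 4 : ℝ) ≠ 0 := by positivity
  exact_mod_cast this


/-! ### The typed statement of the unwritten step and its reduction to one analytic leaf -/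

/-- LEMMA S (S1) of StripLemma.md, typed: a strip half-width `κ > 0` and a constant `c > 0`, depending on
`(d, a₋, a₊, m₊)` only, such that `|E| ≥ c` on `Strip d κ` for EVERY `n = L^j ≥ 1`, `a ∈ [a₋,a₊]`, `m² ∈ [0,m₊²]`.
This is the precise content of "this neighbourhood can be chosen independently of j and … the expression is bounded also in
this neighbourhood" (p. 586) for the denominator; the multiplier sums (S2) and the contour shift (S3) are StripLemma.md D–E. [cite: Balaban1983RegularityDecay, p.586 l.9–11 (ASSERTED without proof in print; proof supplied by the audit, StripLemma.md)] -/
def UniformStrip (d : ℕ) (aminus aplus m2plus : ℝ) : Prop :=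
  ∃ κ c : ℝ, 0 < κ ∧ 0 < c ∧
    ∀ (n : ℕ) [NeZero n] (a m2 : ℝ), aminus ≤ a → a ≤ aplus → 0 ≤ m2 → m2 ≤ m2plus →
      ∀ p ∈ Strip d κ, c ≤ ‖E n a m2 p‖

/-- THE ANALYTIC LEAF (StripLemma.md Lemma A + C: Cauchy's Estimate on coordinate discs of radius `r` inside the fat region,
`Λ = M_E / r` with `M_E = sup_F |E|` bounded independently of `n`): one Lipschitz constant `Λ` in the imaginary directions,
valid on every strip of half-width `κ ≤ r`, for all `n ≥ 1` and all parameters in the ranges. [folklore] -/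
def UniformImLipschitz (d : ℕ) (aminus aplus m2plus r Λ : ℝ) : Prop :=
  0 < r ∧ 0 ≤ Λ ∧
    ∀ (n : ℕ) [NeZero n] (a m2 κ : ℝ), aminus ≤ a → a ≤ aplus → 0 ≤ m2 → m2 ≤ m2plus → 0 < κ → κ ≤ r →
      ImLipschitz d n a m2 κ Λ

/-- REDUCTION (kernel): the analytic leaf implies the uniform strip bound, with the explicit choice
`κ₀ = min r (c / (Λ d + 1))`, `c = ½ a₋ (4/π²)^d` (StripLemma.md (C3): any `κ ≤ r` with `Λ d κ ≤ c` works). [folklore] -/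
theorem uniformStrip_of_uniformImLipschitz (d : ℕ) (aminus aplus m2plus r Λ : ℝ) (ha : 0 < aminus)
    (h : UniformImLipschitz d aminus aplus m2plus r Λ) : UniformStrip d aminus aplus m2plus := by
  obtain ⟨hr, hΛ, hlip⟩ := h
  set c : ℝ := aminus * (4 / Real.pi ^ 2) ^ d / 2 with hc
  have hcpos : 0 < c := by positivity
  have hden : 0 < Λ * d + 1 := by positivity
  refine ⟨min r (c / (Λ * d + 1)), c, lt_min hr (div_pos hcpos hden), hcpos, ?_⟩
  intro n _ a m2 ha1 ha2 hm1 hm2 p hp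
  have hn : 1 ≤ n := Nat.one_le_iff_ne_zero.mpr (NeZero.ne n)
  have ha0 : 0 ≤ a := le_trans ha.le ha1
  set κ := min r (c / (Λ * d + 1)) with hκ
  have hκpos : 0 < κ := lt_min hr (div_pos hcpos hden)
  have hκr : κ ≤ r := min_le_left _ _
  have hL : ImLipschitz d n a m2 κ Λ := hlip n a m2 κ ha1 ha2 hm1 hm2 hκpos hκr
  have hsmall' : Λ * (d * κ) ≤ c := by
    have h1 : κ ≤ c / (Λ * d + 1) := min_le_right _ _
    have h2 : Λ * d * κ ≤ Λ * d * (c / (Λ * d + 1)) :=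
      mul_le_mul_of_nonneg_left h1 (by positivity)
    have h3 : Λ * d * (c / (Λ * d + 1)) ≤ c := by
      rw [mul_div_assoc']
      rw [div_le_iff₀ hden]
      nlinarith
    calc Λ * (d * κ) = Λ * d * κ := by ring
      _ ≤ c := h2.trans h3
  have hca : c ≤ a * (4 / Real.pi ^ 2) ^ d / 2 := by
    rw [hc]
    have : (0:ℝ) ≤ (4 / Real.pi ^ 2) ^ d / 2 := by positivity
    nlinarith
  have hsmall : Λ * (d * κ) ≤ a * (4 / Real.pi ^ 2) ^ d / 2 := hsmall'.trans hca
  exact hca.trans (E_lower_of_ImLipschitz n hn a m2 κ Λ ha0 hm1 hΛ hL hsmall p hp)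

end

end Literature.MathematicalPhysics.QuantumFieldTheory.Balaban1983to89.B4Strip
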